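import Summits.QuantumFields.YangMills.Theorems.FluctuationComparisonRegPrIntLS2BetaClosePairOfOneStep
import Literature.MathematicalPhysics.QuantumFieldTheory.Balaban1983to89.T3Thresholds
import HarnessLib

/-!
# GAP♯∘'s KINEMATIC LETTER — SUM∘ DISCHARGED: the thresholds along a history sum to `O(γ^{1/4})`, uniformly in the depth; hence CLOSE-PAIR∘ ⟸ ONE-STEP∘ alone
# (crux `FluctuationComparisonRegPrIntL`, stmt-QuantumFields-20520; registry v11.4 `Cruxes/FluctuationComparisonRegPrIntL/Lines/semiclassical_s2beta.lean` 3732b7df FROZEN, untouched)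

Cell `ym3-torus` (YM ladder rung R3 = continuum `SU(2)` Yang–Mills on the three-torus — a RUNG: NOT d = 4, NOT infinite volume, NOT a mass gap, NOT Clay).
Seat `ymfull-r3-prover-3` (gen 0; R590-ym (a) item (3)); `--kind proof --supports stmt-QuantumFields-20520 --as helper`, count-neutral, DEFINITION-FREE (0 `def`, 0 `instance`,
0 `notation`, 0 `sorry`, default heartbeats).  Fourth file of the seat; closes the displayed arithmetic letter SUM∘ of `…S2BetaClosePairOfOneStep` (this seat, file 3).

WHAT.  Bałaban's thresholds by distance `i` from the unit scale, `θBal L γ b₀ p₀ i = g_i·p(g_i)`, `g_i = √(γL^{−i})`, satisfy `θBal(i) ≤ C₀·√(√(γ·L^{−i}))`,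
`C₀ = b₀(2p₀)^{p₀}e^{½−p₀}` (✓`T3Thresholds.θBal_le_const_mul_sqrt_coupling`), i.e. a GEOMETRIC sequence of ratio `q = L^{−1/4} < 1` (`L > 1`) times `γ^{1/4}`.  Hence along
any history of depth `K − J` the accumulated one-step closeness radius `C·Σ_{i<K−J} θBal(K−i) ≤ C·C₀·γ^{1/4}/(1 − q)` is bounded UNIFORMLY IN THE DEPTH and tends to `0` with
the unit-scale coupling — the arithmetic half of «small-field histories over one datum are residual-gauge sup-close» ([Balaban1985UV3] p.259, iterated).

* §1 `sqrt_sqrt_mul_pow` (the fourth root of `γ·r^i` is `γ^{1/4}·(r^{1/4})^i`; 4 thms in the file), `sum_pow_sub_le` (`Σ_{i<n} q^{K−i} ≤ 1/(1−q)` for `n ≤ K`, `0 ≤ q < 1`).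
* §2 ★★ `thresholdSum_small` — SUM∘ VERBATIM (the `hS` of ✓`closePair_of_oneStep_of_sum`): `∀ L > 1, b₀ p₀ > 0, C ≥ 0, a₀ > 0, δ > 0, ∃ γ₁ > 0, ∀ γ ∈ (0, γ₁]`,
  `0 ≤ θBal ≤ a₀` at every distance and `C·Σ_{i<K−J} θBal L γ b₀ p₀ (K−i) ≤ δ` for all `J ≤ K`.
* §3 ★★★ `closePair_of_oneStep (h1 : ⟨ONE-STEP∘⟩) : ⟨CLOSE-PAIR∘ VERBATIM⟩` — with ✓p784179: «GAP♯∘ modulo {TUBE-REG∘, ONE-STEP∘, Thm-1 letter}».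

HONEST: elementary real analysis + a door; ONE-STEP∘ ([Balaban1985RegularSpaces] Lemma 1 on one (0.4)-averaging step of the T³ tower), TUBE-REG∘, GAP♯∘, EXW∘, S2β, crux 20520
are NOT proved here; no summit statement is proved by a helper; finite-volume ∕ conditional; rung R3 = SU(2) YM₃ on T³ — NOT d = 4, NOT infinite volume, NOT a mass gap, NOT Clay;
the Yang–Mills mass gap is NOT proved.  Sorry-free, axioms standard.

References: T. Bałaban, CMP **102** (1985) 255–275 [Balaban1985UV3] ((3) p.256, (7) p.257, (12)–(13) p.259); CMP **99** (1985) 75–102 [Balaban1985RegularSpaces] (Lemma 1 (1.24)–(1.26) pp.79–80).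
-/

set_option autoImplicit false

noncomputable section

open MeasureTheory Filter Topology Set
open scoped Matrix.Norms.L2Operator
open Literature.MathematicalPhysics.QuantumFieldTheory.Balaban1983to89
open Literature.MathematicalPhysics.QuantumFieldTheory.Balaban1983to89.T3ContinuumYM3Torus
open Literature.MathematicalPhysics.QuantumFieldTheory.Balaban1983to89.T3UnitLawDensityEML
open Literature.MathematicalPhysics.QuantumFieldTheory.Balaban1983to89.T3UnitScaleTilt
open Literature.MathematicalPhysics.QuantumFieldTheory.Balaban1983to89.T3TiltDescent
open Literature.MathematicalPhysics.QuantumFieldTheory.Balaban1983to89.T3Thresholds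
open Literature.MathematicalPhysics.QuantumFieldTheory.Balaban1983to89.T3MinimiserStabilityReduction (θBal_pos)
open Literature.MathematicalPhysics.QuantumFieldTheory.Balaban1983to89.T3PrintedRegularMinimiser
open Literature.MathematicalPhysics.QuantumFieldTheory.Balaban1983to89.T3ConstrainedMinimiser (fibre)
open Literature.MathematicalPhysics.QuantumFieldTheory.Balaban1983to89.Missing
open Literature.MathematicalPhysics.QuantumFieldTheory.Balaban1983to89.T4Continuum
open Summit.QuantumFields.YangMills.Theorems.FluctuationComparisonRegPrIntLS2BetaClosePairOfOneStep

namespace Summit.QuantumFields.YangMills.Theorems.FluctuationComparisonRegPrIntLS2BetaThresholdSum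

/-! ## §1 Fourth roots and the geometric sum -/

/-- The fourth root of `γ·r^i` is `√√γ · (√√r)^i` (`γ, r ≥ 0`; `√(x^i) = (√x)^i` is the tree's `Literature.NumberTheory.Automorphic.real_sqrt_pow`, re-derived inline
to keep the import cone inside the QFT corner). [folklore] -/
theorem sqrt_sqrt_mul_pow {γ r : ℝ} (hγ : 0 ≤ γ) (hr : 0 ≤ r) (i : ℕ) :
    Real.sqrt (Real.sqrt (γ * r ^ i)) = Real.sqrt (Real.sqrt γ) * Real.sqrt (Real.sqrt r) ^ i := by
  have hsq : ∀ {x : ℝ}, 0 ≤ x → Real.sqrt (x ^ i) = Real.sqrt x ^ i := by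
    intro x hx
    have h : x ^ i = (Real.sqrt x ^ i) ^ 2 := by
      rw [← pow_mul, mul_comm, pow_mul, Real.sq_sqrt hx]
    rw [h, Real.sqrt_sq (pow_nonneg (Real.sqrt_nonneg x) i)]
  rw [Real.sqrt_mul hγ, hsq hr, Real.sqrt_mul (Real.sqrt_nonneg γ), hsq (Real.sqrt_nonneg r)]

/-- `Σ_{i<n} q^{K−i} ≤ 1/(1−q)` for `n ≤ K`, `0 ≤ q < 1` (the exponents `K−i`, `i < n`, are at least `n−1−i`; reflect; finite geometric sum). [folklore] -/
theorem sum_pow_sub_le {q : ℝ} (hq0 : 0 ≤ q) (hq1 : q < 1) {n K : ℕ} (hn : n ≤ K) :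
    ∑ i ∈ Finset.range n, q ^ (K - i) ≤ 1 / (1 - q) := by
  calc ∑ i ∈ Finset.range n, q ^ (K - i) ≤ ∑ i ∈ Finset.range n, q ^ (n - 1 - i) := by
        refine Finset.sum_le_sum fun i hi => ?_
        have hi' := Finset.mem_range.mp hi
        exact pow_le_pow_of_le_one hq0 hq1.le (by omega)
    _ = ∑ i ∈ Finset.range n, q ^ i := Finset.sum_range_reflect (fun i => q ^ i) n
    _ ≤ 1 / (1 - q) := by
        have h := geom_sum_Ico_le_of_lt_one (m := 0) (n := n) hq0 hq1
        rw [pow_zero] at h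
        rwa [Finset.range_eq_Ico]

/-! ## §2 SUM∘ discharged -/

/-- ★★ **SUM∘**: for `L > 1`, `b₀, p₀ > 0`, `C ≥ 0`, `a₀ > 0`, `δ > 0` there is `γ₁ > 0` such that for `0 < γ ≤ γ₁`: `0 ≤ θBal L γ b₀ p₀ i ≤ a₀` at every distance `i`, and
`C·Σ_{i<K−J} θBal L γ b₀ p₀ (K−i) ≤ δ` for all `J ≤ K` — uniformly in the depth (`θBal(i) ≤ C₀·γ^{1/4}·L^{−i/4}`, geometric). [cite: Balaban1985UV3, (3) p.256 and (7) p.257] -/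
theorem thresholdSum_small :
    ∀ (L : ℕ), 1 < L → ∀ (b₀ p₀ : ℝ), 0 < b₀ → 0 < p₀ → ∀ (C a₀ δ : ℝ), 0 ≤ C → 0 < a₀ → 0 < δ →
      ∃ γ₁ : ℝ, 0 < γ₁ ∧ ∀ (γ : ℝ), 0 < γ → γ ≤ γ₁ →
        (∀ i : ℕ, 0 ≤ θBal L γ b₀ p₀ i ∧ θBal L γ b₀ p₀ i ≤ a₀) ∧
        ∀ (J K : ℕ), J ≤ K → C * ∑ i ∈ Finset.range (K - J), θBal L γ b₀ p₀ (K - i) ≤ δ := by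
  intro L hL b₀ p₀ hb hp C a₀ δ hC ha₀ hδ
  have hL1 : 1 ≤ L := hL.le
  have hLr : (1 : ℝ) < L := by exact_mod_cast hL
  -- the constants: `C₀` of `θBal_le_const_mul_sqrt_coupling`, the ratio `q = L^{-1/4}`, `M₀ = C·C₀/(1−q)`
  set C₀ : ℝ := b₀ * ((2 * p₀) ^ p₀ * Real.exp (1 / 2 - p₀)) with hC₀
  have hC₀pos : 0 < C₀ := by positivity
  set r : ℝ := ((L : ℝ))⁻¹ with hr
  have hr0 : 0 ≤ r := inv_nonneg.mpr (by positivity)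
  have hr1 : r < 1 := inv_lt_one_of_one_lt₀ hLr
  set q : ℝ := Real.sqrt (Real.sqrt r) with hq
  have hq0 : 0 ≤ q := Real.sqrt_nonneg _
  have hq1 : q < 1 := by
    have h1 : Real.sqrt r < 1 := (Real.sqrt_lt' one_pos).mpr (by rw [one_pow]; exact hr1)
    exact (Real.sqrt_lt' one_pos).mpr (by rw [one_pow]; exact h1)
  have h1q : 0 < 1 - q := by linarith
  set M₀ : ℝ := C * C₀ / (1 - q) with hM₀
  have hM₀nn : 0 ≤ M₀ := div_nonneg (mul_nonneg hC hC₀pos.le) h1q.le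
  -- the guard threshold and the smallness threshold
  obtain ⟨γa, hγa, hγa1, Ha⟩ := exists_gamma_forall_θBal_le (b₀ := b₀) (p₀ := p₀) hb hp ha₀
  set t : ℝ := δ / (M₀ + 1) with ht
  have ht0 : 0 < t := div_pos hδ (by linarith)
  refine ⟨min γa (t ^ 4), lt_min hγa (by positivity), fun γ hγ hγle => ?_⟩
  have hγa' : γ ≤ γa := hγle.trans (min_le_left _ _)
  have hγ1 : γ ≤ 1 := hγa'.trans hγa1
  have hγt : γ ≤ t ^ 4 := hγle.trans (min_le_right _ _)
  -- `√√γ ≤ t`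
  have hsqrt : Real.sqrt (Real.sqrt γ) ≤ t := by
    have h1 : Real.sqrt γ ≤ t ^ 2 := by
      rw [show t ^ 2 = Real.sqrt ((t ^ 2) ^ 2) from (Real.sqrt_sq (by positivity)).symm]
      exact Real.sqrt_le_sqrt (by rw [← pow_mul]; exact hγt)
    rw [show t = Real.sqrt (t ^ 2) from (Real.sqrt_sq ht0.le).symm]
    exact Real.sqrt_le_sqrt h1
  refine ⟨fun i => ⟨(θBal_pos hL1 hγ hγ1 hb p₀ i).le, Ha L hL1 γ hγ hγa' i⟩, fun J K hJK => ?_⟩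
  -- termwise geometric bound
  have hterm : ∀ i ∈ Finset.range (K - J), θBal L γ b₀ p₀ (K - i) ≤ C₀ * Real.sqrt (Real.sqrt γ) * q ^ (K - i) := by
    intro i _
    have h := θBal_le_const_mul_sqrt_coupling hL1 hγ hγ1 hb.le hp (K - i)
    rw [sqrt_sqrt_mul_pow hγ.le hr0] at h
    simpa only [hC₀, hq, mul_assoc] using h
  calc C * ∑ i ∈ Finset.range (K - J), θBal L γ b₀ p₀ (K - i)
      ≤ C * ∑ i ∈ Finset.range (K - J), C₀ * Real.sqrt (Real.sqrt γ) * q ^ (K - i) :=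
        mul_le_mul_of_nonneg_left (Finset.sum_le_sum hterm) hC
    _ = C * (C₀ * Real.sqrt (Real.sqrt γ)) * ∑ i ∈ Finset.range (K - J), q ^ (K - i) := by
        rw [← Finset.mul_sum]; ring
    _ ≤ C * (C₀ * Real.sqrt (Real.sqrt γ)) * (1 / (1 - q)) :=
        mul_le_mul_of_nonneg_left (sum_pow_sub_le hq0 hq1 (Nat.sub_le K J)) (by positivity)
    _ = M₀ * Real.sqrt (Real.sqrt γ) := by rw [hM₀]; field_simp
    _ ≤ M₀ * t := mul_le_mul_of_nonneg_left hsqrt hM₀nn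
    _ ≤ δ := by
        rw [ht, mul_div_assoc']
        rw [div_le_iff₀ (by linarith)]
        nlinarith

/-! ## §3 CLOSE-PAIR∘ from ONE-STEP∘ alone -/

/-- ★★★ **ONE-STEP∘ ⟹ CLOSE-PAIR∘** (✓`closePair_of_oneStep_of_sum` with SUM∘ discharged by §2): the kinematic letter of GAP♯∘ reduced to [Balaban1985RegularSpaces] Lemma 1 on ONE
averaging step of the T³ tower. [cite: Balaban1985RegularSpaces, Lemma 1 (1.24)-(1.26) pp.79-80; Balaban1985UV3, (12)-(13) p.259] -/
theorem closePair_of_oneStep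
    (h1 : ∀ (L : ℕ), ∃ C : ℝ, 0 ≤ C ∧ ∃ a₀ : ℝ, 0 < a₀ ∧ ∀ (F : T3Family), F.L = L → ∀ (K i : ℕ), i < K →
      ∀ (X X' : GaugeField (F.P K) i (Matrix.specialUnitaryGroup (Fin 2) ℂ))
        (wbar : Site (F.P K) (i + 1) → Matrix.specialUnitaryGroup (Fin 2) ℂ) (α₀ α₁ : ℝ), 0 ≤ α₀ → α₀ ≤ a₀ → 0 ≤ α₁ →
        PlaqSmall α₀ X → PlaqSmall α₀ X' →
        (∀ b : PBond (F.P K) (i + 1),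
          dist1 (((BlockAveraging.blockAvg (P := F.P K) (j := i) ℰp).avg X') b *
            ((GaugeField.gaugeAct wbar ((BlockAveraging.blockAvg (P := F.P K) (j := i) ℰp).avg X)) b)⁻¹) ≤ α₁) →
        ∃ w : Site (F.P K) i → Matrix.specialUnitaryGroup (Fin 2) ℂ,
          (fun y => w (emb y)) = wbar ∧ ∀ ℓ : PBond (F.P K) i, dist1 (X' ℓ * ((GaugeField.gaugeAct w X) ℓ)⁻¹) ≤ α₁ + C * α₀) :
    ∀ (L : ℕ) (b₀ p₀ : ℝ), 0 < b₀ → 0 < p₀ → ∀ (δ : ℝ), 0 < δ →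
      ∃ γ₁ : ℝ, 0 < γ₁ ∧ ∀ (F : T3Family) (γ : ℝ), F.L = L → 0 < γ → γ ≤ γ₁ →
        ∀ (J K : ℕ) (hJK : J ≤ K) (V : GaugeField (F.P J) 0 (Matrix.specialUnitaryGroup (Fin 2) ℂ)),
          ∀ U' ∈ fibre F ℰp J K hJK V, U' ∈ histGood F ℰp (θBal F.L γ b₀ p₀) K J →
            ∀ U ∈ fibre F ℰp J K hJK V, U ∈ histGood F ℰp (θBal F.L γ b₀ p₀) K J →
              ∃ w : Site (F.P K) 0 → Matrix.specialUnitaryGroup (Fin 2) ℂ,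
                (∀ U'' : GaugeField (F.P K) 0 (Matrix.specialUnitaryGroup (Fin 2) ℂ),
                    descendTo F ℰp J K hJK (GaugeField.gaugeAct w U'') = descendTo F ℰp J K hJK U'') ∧
                  ∀ ℓ : PBond (F.P K) 0, dist1 (U ℓ * ((GaugeField.gaugeAct w U') ℓ)⁻¹) ≤ δ :=
  closePair_of_oneStep_of_sum h1 thresholdSum_small

end Summit.QuantumFields.YangMills.Theorems.FluctuationComparisonRegPrIntLS2BetaThresholdSum

end
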